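import Summits.ValiantsHypothesis.ValiantsHypothesis.Theorems.KPlusLogSqLawTropicalBCoupledRegistersDefs

/-!
# Route `KPlusLogSqLaw`, crux `TropicalB` — the COUPLED-REGISTER family, part 2: entries, signs, slope and valuation of a state

HONEST FRAMING.  Helper toward the registered stubs of the crux `TropicalB` (ledger item `stmt-ValiantsHypothesis-19771`, route
`KPlusLogSqLaw`; cell `pub-symmetroid`, seat val-sym-trop-p5 (g3), 2026-08-26).  Bookkeeping for the explicit static `K = 3` family
of part 1 (`…CoupledRegistersDefs`): `|ε| ≤ 1` (`natAbs_ε_le`), staticity (`isStatic`), the entries used by a state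
(`ε_state_of_ne`, `ε_state_self`), its term sign `(−1)^{(N+1)j+t}` (`termSign_state`), its slope `(N+1)j + t` (`slope_state`) and
its valuation `((N+1)j + t)²` (`val_state`) — the states are lattice points of a parabola over consecutive abscissae.  Nothing here
says anything about `TropicalB` in its window, `WeakLifting`, `KPlusLogSqLaw`, `MatrixDescartes` (stmt-ValiantsHypothesis-18050) or
VP ≠ VNP.  [folklore]
-/

set_option linter.dupNamespace false
set_option autoImplicit false

namespace Summit.ValiantsHypothesis.ValiantsHypothesis.Theorems.KPlusLogSqLaw

open Summit.ValiantsHypothesis.ValiantsHypothesis.Theorems.MatrixDescartes.Negative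
open Summit.ValiantsHypothesis.ValiantsHypothesis.Theorems.LacunarySymmetroidMatrixDescartes
open Summit.ValiantsHypothesis.ValiantsHypothesis.Theorems.LacunarySymmetroidMatrixDescartes.TropicalCensus
open Finset

namespace CoupledRegister

variable (N : ℕ)

/-! ## 3. Bookkeeping: sizes of signs, staticity, the entries of a state -/

/-- the coupling sign is `±1` on the coupling block. -/
theorem csign_sq {a b : Fin (2 * N + 1)} (ha : (a : ℕ) ≤ N) (hb : (b : ℕ) ≤ N) : csign N a b * csign N a b = 1 := by
  unfold csign
  rw [dif_pos ⟨ha, hb⟩]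
  set u := Equiv.Perm.sign (perm N ⟨a, Nat.lt_succ_of_le ha⟩ ⟨b, Nat.lt_succ_of_le hb⟩)
  set n := (N + 1) * (a : ℕ) + (b : ℕ)
  have h1 : (u : ℤ) * u = 1 := Int.units_coe_mul_self u
  have h2 : ((-1 : ℤ) ^ n) * (-1) ^ n = 1 := by rw [← mul_pow]; norm_num
  calc (u : ℤ) * (-1) ^ n * ((u : ℤ) * (-1) ^ n) = ((u : ℤ) * u) * (((-1 : ℤ) ^ n) * (-1) ^ n) := by ring
    _ = 1 := by rw [h1, h2, one_mul]

/-- the coupling sign is nonzero on the coupling block. -/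
theorem csign_ne_zero {a b : Fin (2 * N + 1)} (ha : (a : ℕ) ≤ N) (hb : (b : ℕ) ≤ N) : csign N a b ≠ 0 := by
  intro h
  have := csign_sq N ha hb
  rw [h, mul_zero] at this
  exact zero_ne_one this

/-- `|csign| ≤ 1`. -/
theorem natAbs_csign_le (a b : Fin (2 * N + 1)) : (csign N a b).natAbs ≤ 1 := by
  unfold csign
  split_ifs with h
  · rw [Int.natAbs_mul, Int.natAbs_pow, Int.natAbs_neg, Int.natAbs_one, one_pow, mul_one]
    rcases Int.units_eq_one_or (Equiv.Perm.sign (perm N ⟨a, Nat.lt_succ_of_le h.1⟩ ⟨b, Nat.lt_succ_of_le h.2⟩)) with h1 | h1 <;>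
      simp [h1]
  · simp

/-- `|ε| ≤ 1`. -/
theorem natAbs_ε_le (a b : Fin (2 * N + 1)) (l : Fin 3) : (ε N a b l).natAbs ≤ 1 := by
  unfold ε
  split_ifs <;> first | exact natAbs_csign_le N a b | simp

/-- the design is static: every entry carries at most one class. -/
theorem isStatic : IsStatic (ε N) := by
  intro a b l l' h h'
  unfold ε at h h'
  split_ifs at h h' <;> simp_all <;> omega

/-- off the coupling column, the entries of state `(j, t)` are register entries with sign `+1`. -/
theorem ε_state_of_ne (j t : Fin (N + 1)) (b : Fin (2 * N + 1)) (hb : (b : ℕ) ≠ t) :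
    ε N (rowFin N j t b) b (cls N j t b) = 1 := by
  have hj := Nat.le_of_lt_succ j.isLt
  have ht := Nat.le_of_lt_succ t.isLt
  have hb2 := b.isLt
  unfold ε cls clsNat
  simp only [rowFin_val]
  unfold rowNat
  split_ifs <;> simp_all <;> omega

/-- on the coupling column `t`, state `(j, t)` uses the coupling entry `(j, t)` (class `0`) with its coupling sign. -/
theorem ε_state_self (j t : Fin (N + 1)) :
    ε N (rowFin N j t (emb N t)) (emb N t) (cls N j t (emb N t)) = csign N (emb N j) (emb N t) := by
  have hj := Nat.le_of_lt_succ j.isLt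
  have ht := Nat.le_of_lt_succ t.isLt
  have hrow : rowFin N j t (emb N t) = emb N j := by
    apply Fin.ext
    simp only [rowFin_val, emb_val]
    unfold rowNat
    rw [if_pos ht, if_pos rfl]
  have hcls : cls N j t (emb N t) = 0 := by
    unfold cls clsNat
    simp only [emb_val]
    rw [if_pos ht, if_neg (lt_irrefl _)]
  rw [hrow, hcls]
  unfold ε
  rw [if_pos ⟨by simp [hj], by simp [ht]⟩, if_pos rfl]

/-- the coupling sign at `(j, t)` unfolds to `sign σ_{j,t} · (−1)^{(N+1)j+t}`. -/
theorem csign_emb (j t : Fin (N + 1)) :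
    csign N (emb N j) (emb N t) = (Equiv.Perm.sign (perm N j t) : ℤ) * (-1) ^ ((N + 1) * (j : ℕ) + (t : ℕ)) := by
  have hj := Nat.le_of_lt_succ j.isLt
  have ht := Nat.le_of_lt_succ t.isLt
  unfold csign
  rw [dif_pos ⟨by simp [hj], by simp [ht]⟩]
  simp only [emb_val, Fin.eta]

/-- the term sign of state `(j, t)` is `(−1)^{(N+1)j+t}`. -/
theorem termSign_state (j t : Fin (N + 1)) :
    termSign (ε N) (state N j t) = (-1) ^ ((N + 1) * (j : ℕ) + (t : ℕ)) := by
  unfold termSign state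
  simp only [perm_apply]
  rw [Finset.prod_eq_single (emb N t)]
  · rw [ε_state_self, csign_emb, ← mul_assoc, Int.units_coe_mul_self, one_mul]
  · intro b _ hb
    apply ε_state_of_ne
    intro h
    exact hb (Fin.ext (by simp [h]))
  · intro h; exact absurd (Finset.mem_univ _) h

/-- state terms are present. -/
theorem termSign_state_ne_zero (j t : Fin (N + 1)) : termSign (ε N) (state N j t) ≠ 0 := by
  rw [termSign_state]
  exact pow_ne_zero _ (by norm_num)
/-! ## 4. Slope and valuation of a state -/

/-- `|{i : Fin M | lo ≤ i < hi}| = hi − lo` for `hi ≤ M`. [folklore] -/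
theorem card_filter_val_Ico {M : ℕ} (lo hi : ℕ) (h : hi ≤ M) :
    (univ.filter (fun i : Fin M => lo ≤ (i : ℕ) ∧ (i : ℕ) < hi)).card = hi - lo := by
  rw [← Finset.card_map Fin.valEmbedding]
  have : (univ.filter (fun i : Fin M => lo ≤ (i : ℕ) ∧ (i : ℕ) < hi)).map Fin.valEmbedding = Finset.Ico lo hi := by
    ext x
    simp only [Finset.mem_map, Finset.mem_filter, Finset.mem_univ, true_and, Fin.valEmbedding_apply, Finset.mem_Ico]
    constructor
    · rintro ⟨i, hi, rfl⟩; exact hi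
    · intro hx; exact ⟨⟨x, lt_of_lt_of_le hx.2 h⟩, hx, rfl⟩
  rw [this, Nat.card_Ico]

/-- a sum of a constant over a value window of `Fin M`. -/
theorem sum_ite_val_Ico {M : ℕ} (lo hi : ℕ) (h : hi ≤ M) (c : ℤ) :
    ∑ i : Fin M, (if lo ≤ (i : ℕ) ∧ (i : ℕ) < hi then c else 0) = (hi - lo : ℕ) * c := by
  rw [Finset.sum_ite, Finset.sum_const_zero, add_zero, Finset.sum_const, card_filter_val_Ico lo hi h, nsmul_eq_mul]

/-- the exponent of the class used by state `(j, t)` in column `i`, as a sum of two window indicators. -/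
theorem d_clsNat_eq (j t : Fin (N + 1)) (i : Fin (2 * N + 1)) :
    ((d N (clsNat N j t i) : ℕ) : ℤ) =
      (if 0 ≤ (i : ℕ) ∧ (i : ℕ) < t then (1 : ℤ) else 0) +
        (if N + 1 ≤ (i : ℕ) ∧ (i : ℕ) < N + 1 + j then ((N + 1 : ℕ) : ℤ) else 0) := by
  have hj := Nat.le_of_lt_succ j.isLt
  have ht := Nat.le_of_lt_succ t.isLt
  have hi := i.isLt
  unfold d clsNat
  split_ifs <;> simp_all <;> omega

/-- **slope of a state**: `slope σ_{j,t} = (N+1)·j + t`. -/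
theorem slope_state (j t : Fin (N + 1)) :
    TropicalCensus.slope (d N) (state N j t) = (((N + 1) * (j : ℕ) + (t : ℕ) : ℕ) : ℤ) := by
  have hj := Nat.le_of_lt_succ j.isLt
  have ht := Nat.le_of_lt_succ t.isLt
  unfold TropicalCensus.slope state cls
  simp only
  rw [Finset.sum_congr rfl (fun i _ => d_clsNat_eq N j t i), Finset.sum_add_distrib,
    sum_ite_val_Ico 0 t (by omega) 1, sum_ite_val_Ico (N + 1) (N + 1 + j) (by omega)]
  push_cast
  have e1 : ((t : ℕ) - 0 : ℕ) = (t : ℕ) := by omega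
  have e2 : (N + 1 + (j : ℕ) - (N + 1) : ℕ) = (j : ℕ) := by omega
  rw [e1, e2]
  ring

/-- off the coupling column the entries of a state have valuation `0`. -/
theorem v_state_of_ne (j t : Fin (N + 1)) (b : Fin (2 * N + 1)) (hb : (b : ℕ) ≠ t) (l : Fin 3) :
    v N (rowFin N j t b) b l = 0 := by
  have hj := Nat.le_of_lt_succ j.isLt
  have ht := Nat.le_of_lt_succ t.isLt
  have hb2 := b.isLt
  unfold v
  simp only [rowFin_val]
  unfold rowNat
  split_ifs <;> simp_all

/-- the coupling entry of state `(j, t)` has valuation `((N+1)j + t)²`. -/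
theorem v_state_self (j t : Fin (N + 1)) (l : Fin 3) :
    v N (rowFin N j t (emb N t)) (emb N t) l = ((((N + 1) * (j : ℕ) + (t : ℕ) : ℕ) : ℤ)) ^ 2 := by
  have hj := Nat.le_of_lt_succ j.isLt
  have ht := Nat.le_of_lt_succ t.isLt
  have hrow : ((rowFin N j t (emb N t) : Fin (2 * N + 1)) : ℕ) = j := by
    simp only [rowFin_val, emb_val]
    unfold rowNat
    rw [if_pos ht, if_pos rfl]
  unfold v
  rw [hrow, emb_val, if_pos ⟨hj, ht⟩]

/-- **valuation of a state**: `Σ_i v = ((N+1)·j + t)²` — the states lie on a parabola over their slopes. -/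
theorem val_state (j t : Fin (N + 1)) :
    ∑ i, v N ((state N j t).1 i) i ((state N j t).2 i) = ((((N + 1) * (j : ℕ) + (t : ℕ) : ℕ) : ℤ)) ^ 2 := by
  unfold state
  simp only [perm_apply]
  rw [Finset.sum_eq_single (emb N t)]
  · exact v_state_self N j t _
  · intro b _ hb
    apply v_state_of_ne
    intro h
    exact hb (Fin.ext (by simp [h]))
  · intro h; exact absurd (Finset.mem_univ _) h

end CoupledRegister

end Summit.ValiantsHypothesis.ValiantsHypothesis.Theorems.KPlusLogSqLaw
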